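import Literature.NumberTheory.Rogawski1990.ArchSingularPinTopFormRatio              -- ★ p843734 (J-val-K) `hK` plumbing + what it buys
import Literature.NumberTheory.Rogawski1990.ArchSingularCentralizerPinsExist          -- ★ p843599 (W3-pins) one-stop (binder shapes `ρZ ρP ρ′ T`)
import Literature.NumberTheory.Weil1964.UnitaryArchSingularCentralizerTopFormHaarCoherence   -- ★ `map_subgroupCongrHomeomorph_conj_centralizerTopFormHaar`
import Literature.NumberTheory.Rogawski1990.ArchLimitFormula                         -- ★ the (J-nc) letter's vocabulary (`descConj`, `quotientMeasure`)
import HarnessLib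

/-!
# (U) — THE UNIVERSAL, WITNESS-FREE FORM OF (J-val-K) (text of record, LEAD F0P3a-plan (g10) WORD T9-22 (3)), and «(U) ⟹ `hK`» for every coherent torus datum that
# passes through the pinned telescopes (Rogawski 1990 §1.7 p. 6, §4.3 (4.3.1) p. 43, §8.2 pp. 119–124, §14.5 p. 239)

Topic `NumberTheory/Rogawski1990`; namespace `Literature.NumberTheory.Rogawski1990`.  THEOREMS ONLY (no definition, no instance, no notation, no named fact, no `sorry`).  Cell
`pub/hodgecm-mathlib`, ENGINE T1, crux H413 = `stmt-HodgeConjecture-24833` (supports-only); F0P3-p03 (g10) census `CENSUS-Jval-ArchCovolumeRatio` cbbd319c + DESIGN NOTE 10:53:03Z,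
LEAD WORD T9-22 (3) «(W-b) + (b0); (U) is the (J-val-K) text of record».  Count-neutral.  HONEST LABEL: HC_CM is proved only modulo the printed citations until rung 0 closes.

THE HYPOTHESIS (U) (binder `hU` of `smul_centralizerTopFormHaar_of_universal_pinRatio` below, for a constant `K ≠ 0`; the reference wall points `z₁` and the quotient σ-algebras
are the theorem's parameters):  for EVERY reference family `νH w τ` (Haar, inversion invariant) pinned at the noncompact walls by the (J-nc) clause with constant `−1` (`hpin`, the
clause of ★ `ArchLimitFormulaNoncompactWall` VERBATIM for some Haar group measure — any, ★ `archLimitFormulaNoncompactWall_clause_of_isHaarMeasure`), EVERY wall datum `z` of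
RATIONAL TYPE (`z_w = (σ_w a, σ_w b, σ_w a)`, `a ≠ b ∈ L` — the only wall classes the S1′ guard meets), EVERY relabelling `ρ`, EVERY per-place family `ρZ` with ★ (D5)'s `hρZi`,
`hρZ` (transport of `νH w σ⁻¹` at the noncompact walls) and PROBABILITY mass at the compact walls, and EVERY telescope `ρP ρ′` (`hρP hρ′`):
  `centralizerTopFormHaar L (diagonal α) (t(z∘ρ)) = K • ρ′`.
It is closed and witness-free (pin (i) determines `ρZ`, hence `ρ′`, uniquely: ★ `centralizer_measure_eq_of_clause`, Haar-probability uniqueness); it is (per place) the printed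
VALUE «compatible measures give matched singular constants» [Rogawski1990 §8.2 pp. 119–124; §1.7 p. 6] × the product structure of ★ A-p19's `centralizerTopFormHaar`, in one line;
its discharge is the D-T road's (per-place top-form factors), not this generation.

* **`smul_centralizerTopFormHaar_of_universal_pinRatio`** — (U) with constant `K` ⟹ for ANY torus datum `T` on `U(diag α)(L⁺ ⊗ ℝ)` that is conjugation-coherent on the wall classes
  of an injective family of rational-type wall data and passes through pinned telescopes at the wall torus points (`T (t(z0 k∘ρ)) = ρ′ k ρ` — ★ (W3-pins) one-stop's outputs),
  and framed there (★ `IsSingularArchFrame`): `T γ = K⁻¹ • centralizerTopFormHaar L (diagonal α) γ` on ALL those wall classes — i.e. ★ p843734's `hK` with the constant `K⁻¹`,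
  ONE constant for all classes (★ `map_subgroupCongrHomeomorph_conj_centralizerTopFormHaar` carries the torus-point identity along conjugators).  With (b0) (transport of
  `centralizerTopFormHaar` along form congruences) the same holds for the Ψ-pullback datum on `U(H′)(L⁺ ⊗ ℝ)`, where ★ (W4d) reads it.

## References
* [Rogawski1990] J. D. Rogawski, *Automorphic Representations of Unitary Groups in Three Variables*, Ann. of Math. Stud. 123 (1990), §1.7 p. 6; §4.3 (4.3.1) p. 43; §8.2
  pp. 119–124; §14.5 Lemma 14.5.2 (b) p. 239.
* [DeitmarEchterhoff2014] A. Deitmar, S. Echterhoff, *Principles of Harmonic Analysis*, 2nd ed. (2014), Thm. 1.5.3.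
* [Kottwitz1988] R. E. Kottwitz, *Tamagawa numbers*, Ann. of Math. 127 (1988), Prop. 2.
-/

set_option autoImplicit false

noncomputable section

open MeasureTheory Measure Set Filter Topology NumberField NumberField.InfinitePlace NumberField.mixedEmbedding Matrix Equiv
open Literature.MeasureTheory.Group Literature.NumberTheory.Automorphic Literature.NumberTheory.Automorphic.UnitaryGroup
open Literature.NumberTheory.Weil1964 Literature.NumberTheory.Weil1964.UnitaryArchTopForm
open scoped ENNReal NNReal Classical Matrix MatrixGroups Matrix.Norms.Operator ContDiff

namespace Literature.NumberTheory.Rogawski1990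

variable (L : Type) [Field L] [NumberField L] [IsCMField L] (α : Fin 3 → L)
  [MeasurableSpace (GL (Fin 3) ℂ)] [BorelSpace (GL (Fin 3) ℂ)]
  [MeasurableSpace (arch (↥(maximalRealSubfield L)) L (IsCMField.complexConj L) 3 (Matrix.diagonal α))] [BorelSpace (arch (↥(maximalRealSubfield L)) L (IsCMField.complexConj L) 3 (Matrix.diagonal α))]

/-- **(U) ⟹ (J-val-K) FOR EVERY COHERENT DATUM THROUGH THE PINNED TELESCOPES.**  Hypothesis `hU` = the universal (J-val-K) text of record (module docstring) with constant
`K ≠ 0`.  Data: the reference family `νH` with its `(−1)`-pins (`hpin`), an injective family `z0 k` of RATIONAL-TYPE wall data with pinned per-place families `ρZ k` (★ (D5)'s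
`hρZi hρZ` + probability at compact walls) and telescopes `ρP k ρ`, `ρ′ k ρ` (`hρP hρ′`), a torus datum `T` with `T (t(z0 k∘ρ)) = ρ′ k ρ` (★ (W3-pins)) and conjugation-coherent on
the union of the wall classes, framed at the wall torus points.  Conclusion: `T γ = K⁻¹ • centralizerTopFormHaar L (diagonal α) γ` at every point of every wall class — ★ p843734's
`hK` with ONE constant. [cite: Rogawski1990, §1.7 p. 6; §4.3 (4.3.1) p. 43; §8.2 pp. 119–124; §14.5 p. 239] [cite: DeitmarEchterhoff2014, Thm. 1.5.3] -/
theorem smul_centralizerTopFormHaar_of_universal_pinRatio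
    (z₁ : {w : InfinitePlace L // IsComplex w} → Fin 3 → Circle) (h02 : ∀ w, z₁ w 0 = z₁ w 2) (h01 : ∀ w, z₁ w 0 ≠ z₁ w 1)
    [∀ (w : {w : InfinitePlace L // IsComplex w}) (τ : Perm (Fin 3)), MeasurableSpace (archLocal L 3 (Matrix.diagonal (α ∘ ⇑τ)) w ⧸ Subgroup.centralizer ({(⟨circleDiagonal 3 (z₁ w), circleDiagonal_mem_archLocal_diagonal L 3 (α ∘ ⇑τ) w (z₁ w)⟩ : archLocal L 3 (Matrix.diagonal (α ∘ ⇑τ)) w)} : Set (archLocal L 3 (Matrix.diagonal (α ∘ ⇑τ)) w)))]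
    [∀ (w : {w : InfinitePlace L // IsComplex w}) (τ : Perm (Fin 3)), BorelSpace (archLocal L 3 (Matrix.diagonal (α ∘ ⇑τ)) w ⧸ Subgroup.centralizer ({(⟨circleDiagonal 3 (z₁ w), circleDiagonal_mem_archLocal_diagonal L 3 (α ∘ ⇑τ) w (z₁ w)⟩ : archLocal L 3 (Matrix.diagonal (α ∘ ⇑τ)) w)} : Set (archLocal L 3 (Matrix.diagonal (α ∘ ⇑τ)) w)))]
    (K : ℝ≥0) (hK : K ≠ 0)
    -- ===== (U): THE UNIVERSAL (J-val-K) HYPOTHESIS OF RECORD =====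
    (hU : ∀ (νH : ∀ (w : {w : InfinitePlace L // IsComplex w}) (τ : Perm (Fin 3)), Measure (Subgroup.centralizer ({(⟨circleDiagonal 3 (z₁ w), circleDiagonal_mem_archLocal_diagonal L 3 (α ∘ ⇑τ) w (z₁ w)⟩ : archLocal L 3 (Matrix.diagonal (α ∘ ⇑τ)) w)} : Set (archLocal L 3 (Matrix.diagonal (α ∘ ⇑τ)) w))))
        (hνH : ∀ w τ, (νH w τ).IsHaarMeasure ∧ (νH w τ).IsInvInvariant)
        (hpin : ∀ (w : {w : InfinitePlace L // IsComplex w}) (τ : Perm (Fin 3)), (w.1.embedding (α (τ 0))).re * (w.1.embedding (α (τ 2))).re < 0 →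
        haveI : LocallyCompactSpace (archLocal L 3 (Matrix.diagonal (α ∘ ⇑τ)) w) := locallyCompactSpace_archLocal L 3 (Matrix.diagonal (α ∘ ⇑τ)) w
        haveI : SecondCountableTopology (archLocal L 3 (Matrix.diagonal (α ∘ ⇑τ)) w) := secondCountableTopology_archLocal L 3 (Matrix.diagonal (α ∘ ⇑τ)) w
        haveI : (νH w τ).IsHaarMeasure := (hνH w τ).1
        haveI : (νH w τ).IsInvInvariant := (hνH w τ).2
        ∃ (ν : Measure (archLocal L 3 (Matrix.diagonal (α ∘ ⇑τ)) w)) (_ : ν.IsHaarMeasure) (_ : ν.IsMulRightInvariant),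
          ∀ (Θ : Matrix (Fin 3) (Fin 3) ℂ → ℂ), ContDiff ℝ (⊤ : ℕ∞) Θ →
            HasCompactSupport (fun k : archLocal L 3 (Matrix.diagonal (α ∘ ⇑τ)) w => Θ ((k : GL (Fin 3) ℂ) : Matrix (Fin 3) (Fin 3) ℂ)) →
            ∀ (z₀ : Fin 3 → Circle) (h02' : z₀ 0 = z₀ 2) (h01' : z₀ 0 ≠ z₀ 1),
              Tendsto (fun ψ : ℝ => deriv (fun ψ : ℝ => (2 * Real.sin ψ : ℂ) *
                  ∫ g, Θ (((g * ⟨circleDiagonal 3 (fun i => z₀ i * Circle.exp (![(1 : ℝ), 0, -1] i * ψ)),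
                    circleDiagonal_mem_archLocal_diagonal L 3 (α ∘ ⇑τ) w _⟩ * g⁻¹ : archLocal L 3 (Matrix.diagonal (α ∘ ⇑τ)) w) : GL (Fin 3) ℂ) : Matrix (Fin 3) (Fin 3) ℂ) ∂(ν)) ψ)
                (𝓝[≠] 0)
                (𝓝 ((-1 : ℂ) * ∫ y, descConj (⟨circleDiagonal 3 z₀, circleDiagonal_mem_archLocal_diagonal L 3 (α ∘ ⇑τ) w z₀⟩ : archLocal L 3 (Matrix.diagonal (α ∘ ⇑τ)) w)
                  (Subgroup.centralizer ({(⟨circleDiagonal 3 (z₁ w), circleDiagonal_mem_archLocal_diagonal L 3 (α ∘ ⇑τ) w (z₁ w)⟩ : archLocal L 3 (Matrix.diagonal (α ∘ ⇑τ)) w)} : Set (archLocal L 3 (Matrix.diagonal (α ∘ ⇑τ)) w)))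
                  (forall_mem_centralizer_circleDiagonal_comm_of_wall L (α ∘ ⇑τ) w (h02 w) (h01 w) h02' h01')
                  (fun k : archLocal L 3 (Matrix.diagonal (α ∘ ⇑τ)) w => Θ ((k : GL (Fin 3) ℂ) : Matrix (Fin 3) (Fin 3) ℂ)) y
                  ∂(quotientMeasure _ (νH w τ) (isClosed_coe_centralizer_singleton _) (ν)))))
        (z : {w : InfinitePlace L // IsComplex w} → Fin 3 → Circle) (hwall : ∀ w, z w 0 = z w 2 ∧ z w 0 ≠ z w 1)
        (_hrat : ∃ a b : L, ∀ w : {w : InfinitePlace L // IsComplex w}, ((z w 0 : ℂ) = w.1.embedding a) ∧ ((z w 1 : ℂ) = w.1.embedding b))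
        (ρ : {w : InfinitePlace L // IsComplex w} → Perm (Fin 3))
        (ρZ : ∀ (w : {w : InfinitePlace L // IsComplex w}) (σ : Perm (Fin 3)), Measure (Subgroup.centralizer ({(⟨circleDiagonal 3 (z w ∘ ⇑σ), circleDiagonal_mem_archLocal_diagonal L 3 α w (z w ∘ ⇑σ)⟩ : archLocal L 3 (Matrix.diagonal α) w)} : Set (archLocal L 3 (Matrix.diagonal α) w))))
        (_hρZi : ∀ w σ, (ρZ w σ).IsHaarMeasure ∧ (ρZ w σ).IsInvInvariant)
        (_hρZ : ∀ (w : {w : InfinitePlace L // IsComplex w}) (σ : Perm (Fin 3)), ¬ 0 < (w.1.embedding (α (σ⁻¹ 0))).re * (w.1.embedding (α (σ⁻¹ 2))).re →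
          ρZ w σ = (νH w σ⁻¹).map (subgroupCongrHomeomorph (ContinuousMulEquiv.restrictSubgroup (GLn.conjEquiv (Matrix.GeneralLinearGroup.mkOfDetNeZero _ (det_monomial_one_ne_zero 3 σ⁻¹))) (archLocal L 3 (Matrix.diagonal (α ∘ ⇑σ⁻¹)) w) (archLocal L 3 (Matrix.diagonal α) w) (mem_archLocal_comp_perm_iff_conj_mem L 3 α w σ⁻¹)).toMulEquiv
        (Subgroup.centralizer ({(⟨circleDiagonal 3 (z₁ w), circleDiagonal_mem_archLocal_diagonal L 3 (α ∘ ⇑σ⁻¹) w (z₁ w)⟩ : archLocal L 3 (Matrix.diagonal (α ∘ ⇑σ⁻¹)) w)} : Set (archLocal L 3 (Matrix.diagonal (α ∘ ⇑σ⁻¹)) w)))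
        (Subgroup.centralizer ({(⟨circleDiagonal 3 (z w ∘ ⇑σ), circleDiagonal_mem_archLocal_diagonal L 3 α w (z w ∘ ⇑σ)⟩ : archLocal L 3 (Matrix.diagonal α) w)} : Set (archLocal L 3 (Matrix.diagonal α) w)))
        (relabel_inv_mem_centralizer_circleDiagonal_comp_iff L α w σ (h02 w) (h01 w) (hwall w).1 (hwall w).2)
        (ContinuousMulEquiv.restrictSubgroup (GLn.conjEquiv (Matrix.GeneralLinearGroup.mkOfDetNeZero _ (det_monomial_one_ne_zero 3 σ⁻¹))) (archLocal L 3 (Matrix.diagonal (α ∘ ⇑σ⁻¹)) w) (archLocal L 3 (Matrix.diagonal α) w) (mem_archLocal_comp_perm_iff_conj_mem L 3 α w σ⁻¹)).continuous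
        (ContinuousMulEquiv.restrictSubgroup (GLn.conjEquiv (Matrix.GeneralLinearGroup.mkOfDetNeZero _ (det_monomial_one_ne_zero 3 σ⁻¹))) (archLocal L 3 (Matrix.diagonal (α ∘ ⇑σ⁻¹)) w) (archLocal L 3 (Matrix.diagonal α) w) (mem_archLocal_comp_perm_iff_conj_mem L 3 α w σ⁻¹)).symm.continuous))
        (_hρZ1 : ∀ (w : {w : InfinitePlace L // IsComplex w}) (σ : Perm (Fin 3)), 0 < (w.1.embedding (α (σ⁻¹ 0))).re * (w.1.embedding (α (σ⁻¹ 2))).re → ρZ w σ Set.univ = 1)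
        (ρP : Measure (Subgroup.pi Set.univ (fun w : {w : InfinitePlace L // IsComplex w} => Subgroup.centralizer ({(⟨circleDiagonal 3 (z w ∘ ⇑(ρ w)), circleDiagonal_mem_archLocal_diagonal L 3 α w (z w ∘ ⇑(ρ w))⟩ : archLocal L 3 (Matrix.diagonal α) w)} : Set (archLocal L 3 (Matrix.diagonal α) w)))))
        (_hρP : Measure.map (subgroupPiCoords fun w : {w : InfinitePlace L // IsComplex w} => Subgroup.centralizer ({(⟨circleDiagonal 3 (z w ∘ ⇑(ρ w)), circleDiagonal_mem_archLocal_diagonal L 3 α w (z w ∘ ⇑(ρ w))⟩ : archLocal L 3 (Matrix.diagonal α) w)} : Set (archLocal L 3 (Matrix.diagonal α) w))) ρP = Measure.pi fun w => ρZ w (ρ w))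
        (ρ' : Measure (Subgroup.centralizer ({archDiagTorus L 3 α (fun w => z w ∘ ⇑(ρ w))} : Set (arch (↥(maximalRealSubfield L)) L (IsCMField.complexConj L) 3 (Matrix.diagonal α)))))
        (_hρ' : ρ' = ρP.map (subgroupCongrHomeomorph (archPiEquivCM 3 L (Matrix.diagonal α)).symm.toMulEquiv (Subgroup.pi Set.univ (fun w : {w : InfinitePlace L // IsComplex w} => Subgroup.centralizer ({(⟨circleDiagonal 3 (z w ∘ ⇑(ρ w)), circleDiagonal_mem_archLocal_diagonal L 3 α w (z w ∘ ⇑(ρ w))⟩ : archLocal L 3 (Matrix.diagonal α) w)} : Set (archLocal L 3 (Matrix.diagonal α) w)))) (Subgroup.centralizer ({archDiagTorus L 3 α (fun w => z w ∘ ⇑(ρ w))} : Set (arch (↥(maximalRealSubfield L)) L (IsCMField.complexConj L) 3 (Matrix.diagonal α)))) (apply_mem_centralizer_iff_mem_pi_centralizer _ (archPiEquivCM 3 L (Matrix.diagonal α)).symm.toMulEquiv (archPiEquivCM_symm_circleDiagonal_eq_archDiagTorus L 3 α (fun w => z w ∘ ⇑(ρ w)))) (archPiEquivCM 3 L (Matrix.diagonal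 α)).symm.continuous (archPiEquivCM 3 L (Matrix.diagonal α)).continuous)),
        centralizerTopFormHaar L (Matrix.diagonal α) (archDiagTorus L 3 α (fun w => z w ∘ ⇑(ρ w))) = K • ρ')
    -- ===== the data it is applied to =====
    (νH : ∀ (w : {w : InfinitePlace L // IsComplex w}) (τ : Perm (Fin 3)), Measure (Subgroup.centralizer ({(⟨circleDiagonal 3 (z₁ w), circleDiagonal_mem_archLocal_diagonal L 3 (α ∘ ⇑τ) w (z₁ w)⟩ : archLocal L 3 (Matrix.diagonal (α ∘ ⇑τ)) w)} : Set (archLocal L 3 (Matrix.diagonal (α ∘ ⇑τ)) w))))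
    (hνH : ∀ w τ, (νH w τ).IsHaarMeasure ∧ (νH w τ).IsInvInvariant)
    (hpin : ∀ (w : {w : InfinitePlace L // IsComplex w}) (τ : Perm (Fin 3)), (w.1.embedding (α (τ 0))).re * (w.1.embedding (α (τ 2))).re < 0 →
        haveI : LocallyCompactSpace (archLocal L 3 (Matrix.diagonal (α ∘ ⇑τ)) w) := locallyCompactSpace_archLocal L 3 (Matrix.diagonal (α ∘ ⇑τ)) w
        haveI : SecondCountableTopology (archLocal L 3 (Matrix.diagonal (α ∘ ⇑τ)) w) := secondCountableTopology_archLocal L 3 (Matrix.diagonal (α ∘ ⇑τ)) w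
        haveI : (νH w τ).IsHaarMeasure := (hνH w τ).1
        haveI : (νH w τ).IsInvInvariant := (hνH w τ).2
        ∃ (ν : Measure (archLocal L 3 (Matrix.diagonal (α ∘ ⇑τ)) w)) (_ : ν.IsHaarMeasure) (_ : ν.IsMulRightInvariant),
          ∀ (Θ : Matrix (Fin 3) (Fin 3) ℂ → ℂ), ContDiff ℝ (⊤ : ℕ∞) Θ →
            HasCompactSupport (fun k : archLocal L 3 (Matrix.diagonal (α ∘ ⇑τ)) w => Θ ((k : GL (Fin 3) ℂ) : Matrix (Fin 3) (Fin 3) ℂ)) →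
            ∀ (z₀ : Fin 3 → Circle) (h02' : z₀ 0 = z₀ 2) (h01' : z₀ 0 ≠ z₀ 1),
              Tendsto (fun ψ : ℝ => deriv (fun ψ : ℝ => (2 * Real.sin ψ : ℂ) *
                  ∫ g, Θ (((g * ⟨circleDiagonal 3 (fun i => z₀ i * Circle.exp (![(1 : ℝ), 0, -1] i * ψ)),
                    circleDiagonal_mem_archLocal_diagonal L 3 (α ∘ ⇑τ) w _⟩ * g⁻¹ : archLocal L 3 (Matrix.diagonal (α ∘ ⇑τ)) w) : GL (Fin 3) ℂ) : Matrix (Fin 3) (Fin 3) ℂ) ∂(ν)) ψ)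
                (𝓝[≠] 0)
                (𝓝 ((-1 : ℂ) * ∫ y, descConj (⟨circleDiagonal 3 z₀, circleDiagonal_mem_archLocal_diagonal L 3 (α ∘ ⇑τ) w z₀⟩ : archLocal L 3 (Matrix.diagonal (α ∘ ⇑τ)) w)
                  (Subgroup.centralizer ({(⟨circleDiagonal 3 (z₁ w), circleDiagonal_mem_archLocal_diagonal L 3 (α ∘ ⇑τ) w (z₁ w)⟩ : archLocal L 3 (Matrix.diagonal (α ∘ ⇑τ)) w)} : Set (archLocal L 3 (Matrix.diagonal (α ∘ ⇑τ)) w)))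
                  (forall_mem_centralizer_circleDiagonal_comm_of_wall L (α ∘ ⇑τ) w (h02 w) (h01 w) h02' h01')
                  (fun k : archLocal L 3 (Matrix.diagonal (α ∘ ⇑τ)) w => Θ ((k : GL (Fin 3) ℂ) : Matrix (Fin 3) (Fin 3) ℂ)) y
                  ∂(quotientMeasure _ (νH w τ) (isClosed_coe_centralizer_singleton _) (ν)))))
    {κ : Type*} (z0 : κ → {w : InfinitePlace L // IsComplex w} → Fin 3 → Circle) (hwall : ∀ k w, z0 k w 0 = z0 k w 2 ∧ z0 k w 0 ≠ z0 k w 1)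
    (hrat : ∀ k, ∃ a b : L, ∀ w : {w : InfinitePlace L // IsComplex w}, ((z0 k w 0 : ℂ) = w.1.embedding a) ∧ ((z0 k w 1 : ℂ) = w.1.embedding b))
    (ρZ : ∀ (k : κ) (w : {w : InfinitePlace L // IsComplex w}) (σ : Perm (Fin 3)), Measure (Subgroup.centralizer ({(⟨circleDiagonal 3 (z0 k w ∘ ⇑σ), circleDiagonal_mem_archLocal_diagonal L 3 α w (z0 k w ∘ ⇑σ)⟩ : archLocal L 3 (Matrix.diagonal α) w)} : Set (archLocal L 3 (Matrix.diagonal α) w))))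
    (hρZi : ∀ k w σ, (ρZ k w σ).IsHaarMeasure ∧ (ρZ k w σ).IsInvInvariant)
    (hρZ : ∀ (k : κ) (w : {w : InfinitePlace L // IsComplex w}) (σ : Perm (Fin 3)), ¬ 0 < (w.1.embedding (α (σ⁻¹ 0))).re * (w.1.embedding (α (σ⁻¹ 2))).re →
      ρZ k w σ = (νH w σ⁻¹).map (subgroupCongrHomeomorph (ContinuousMulEquiv.restrictSubgroup (GLn.conjEquiv (Matrix.GeneralLinearGroup.mkOfDetNeZero _ (det_monomial_one_ne_zero 3 σ⁻¹))) (archLocal L 3 (Matrix.diagonal (α ∘ ⇑σ⁻¹)) w) (archLocal L 3 (Matrix.diagonal α) w) (mem_archLocal_comp_perm_iff_conj_mem L 3 α w σ⁻¹)).toMulEquiv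
        (Subgroup.centralizer ({(⟨circleDiagonal 3 (z₁ w), circleDiagonal_mem_archLocal_diagonal L 3 (α ∘ ⇑σ⁻¹) w (z₁ w)⟩ : archLocal L 3 (Matrix.diagonal (α ∘ ⇑σ⁻¹)) w)} : Set (archLocal L 3 (Matrix.diagonal (α ∘ ⇑σ⁻¹)) w)))
        (Subgroup.centralizer ({(⟨circleDiagonal 3 (z0 k w ∘ ⇑σ), circleDiagonal_mem_archLocal_diagonal L 3 α w (z0 k w ∘ ⇑σ)⟩ : archLocal L 3 (Matrix.diagonal α) w)} : Set (archLocal L 3 (Matrix.diagonal α) w)))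
        (relabel_inv_mem_centralizer_circleDiagonal_comp_iff L α w σ (h02 w) (h01 w) (hwall k w).1 (hwall k w).2)
        (ContinuousMulEquiv.restrictSubgroup (GLn.conjEquiv (Matrix.GeneralLinearGroup.mkOfDetNeZero _ (det_monomial_one_ne_zero 3 σ⁻¹))) (archLocal L 3 (Matrix.diagonal (α ∘ ⇑σ⁻¹)) w) (archLocal L 3 (Matrix.diagonal α) w) (mem_archLocal_comp_perm_iff_conj_mem L 3 α w σ⁻¹)).continuous
        (ContinuousMulEquiv.restrictSubgroup (GLn.conjEquiv (Matrix.GeneralLinearGroup.mkOfDetNeZero _ (det_monomial_one_ne_zero 3 σ⁻¹))) (archLocal L 3 (Matrix.diagonal (α ∘ ⇑σ⁻¹)) w) (archLocal L 3 (Matrix.diagonal α) w) (mem_archLocal_comp_perm_iff_conj_mem L 3 α w σ⁻¹)).symm.continuous))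
    (hρZ1 : ∀ (k : κ) (w : {w : InfinitePlace L // IsComplex w}) (σ : Perm (Fin 3)), 0 < (w.1.embedding (α (σ⁻¹ 0))).re * (w.1.embedding (α (σ⁻¹ 2))).re → ρZ k w σ Set.univ = 1)
    (ρP : ∀ (k : κ) (ρ : {w : InfinitePlace L // IsComplex w} → Perm (Fin 3)), Measure (Subgroup.pi Set.univ (fun w : {w : InfinitePlace L // IsComplex w} => Subgroup.centralizer ({(⟨circleDiagonal 3 (z0 k w ∘ ⇑(ρ w)), circleDiagonal_mem_archLocal_diagonal L 3 α w (z0 k w ∘ ⇑(ρ w))⟩ : archLocal L 3 (Matrix.diagonal α) w)} : Set (archLocal L 3 (Matrix.diagonal α) w)))))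
    (hρP : ∀ (k : κ) (ρ : {w : InfinitePlace L // IsComplex w} → Perm (Fin 3)), Measure.map (subgroupPiCoords fun w : {w : InfinitePlace L // IsComplex w} => Subgroup.centralizer ({(⟨circleDiagonal 3 (z0 k w ∘ ⇑(ρ w)), circleDiagonal_mem_archLocal_diagonal L 3 α w (z0 k w ∘ ⇑(ρ w))⟩ : archLocal L 3 (Matrix.diagonal α) w)} : Set (archLocal L 3 (Matrix.diagonal α) w))) (ρP k ρ) = Measure.pi fun w => ρZ k w (ρ w))
    (ρ' : ∀ (k : κ) (ρ : {w : InfinitePlace L // IsComplex w} → Perm (Fin 3)), Measure (Subgroup.centralizer ({archDiagTorus L 3 α (fun w => z0 k w ∘ ⇑(ρ w))} : Set (arch (↥(maximalRealSubfield L)) L (IsCMField.complexConj L) 3 (Matrix.diagonal α)))))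
    (hρ' : ∀ (k : κ) (ρ : {w : InfinitePlace L // IsComplex w} → Perm (Fin 3)), ρ' k ρ = (ρP k ρ).map (subgroupCongrHomeomorph (archPiEquivCM 3 L (Matrix.diagonal α)).symm.toMulEquiv (Subgroup.pi Set.univ (fun w : {w : InfinitePlace L // IsComplex w} => Subgroup.centralizer ({(⟨circleDiagonal 3 (z0 k w ∘ ⇑(ρ w)), circleDiagonal_mem_archLocal_diagonal L 3 α w (z0 k w ∘ ⇑(ρ w))⟩ : archLocal L 3 (Matrix.diagonal α) w)} : Set (archLocal L 3 (Matrix.diagonal α) w)))) (Subgroup.centralizer ({archDiagTorus L 3 α (fun w => z0 k w ∘ ⇑(ρ w))} : Set (arch (↥(maximalRealSubfield L)) L (IsCMField.complexConj L) 3 (Matrix.diagonal α)))) (apply_mem_centralizer_iff_mem_pi_centralizer _ (archPiEquivCM 3 L (Matrix.diagonal α)).symm.toMulEquiv (archPiEquivCM_symm_circleDiagonal_eq_archDiagTorus L 3 α (fun w => z0 k w ∘ ⇑(ρ w)))) (archPiEquivCM 3 L (Matrix.diagonal α)).symm.continuous (archPiEquivCM 3 L (Matrix.diagonal α)).continuo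us))
    (T : ∀ γ : arch (↥(maximalRealSubfield L)) L (IsCMField.complexConj L) 3 (Matrix.diagonal α), Measure (Subgroup.centralizer ({γ} : Set (arch (↥(maximalRealSubfield L)) L (IsCMField.complexConj L) 3 (Matrix.diagonal α)))))
    (hTtor : ∀ (k : κ) (ρ : {w : InfinitePlace L // IsComplex w} → Perm (Fin 3)), T (archDiagTorus L 3 α (fun w => z0 k w ∘ ⇑(ρ w))) = ρ' k ρ)
    (hcoh : ∀ (γ₁ γ₂ Q : arch (↥(maximalRealSubfield L)) L (IsCMField.complexConj L) 3 (Matrix.diagonal α)) (hQ : (MulAut.conj Q : arch (↥(maximalRealSubfield L)) L (IsCMField.complexConj L) 3 (Matrix.diagonal α) ≃* arch (↥(maximalRealSubfield L)) L (IsCMField.complexConj L) 3 (Matrix.diagonal α)) γ₁ = γ₂), (∃ (k : κ) (ρ : {w : InfinitePlace L // IsComplex w} → Perm (Fin 3)) (q : arch (↥(maximalRealSubfield L)) L (IsCMField.complexConj L) 3 (Matrix.diagonal α)), (MulAut.conj q : arch (↥(maximalRealSubfield L)) L (IsCMField.complexConj L) 3 (Matrix.diagonal α) ≃* arch (↥(maximalRealSubfield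 L)) L (IsCMField.complexConj L) 3 (Matrix.diagonal α)) (archDiagTorus L 3 α (fun w => z0 k w ∘ ⇑(ρ w))) = γ₁) →
      (T γ₁).map (subgroupCongrHomeomorph (MulAut.conj Q : arch (↥(maximalRealSubfield L)) L (IsCMField.complexConj L) 3 (Matrix.diagonal α) ≃* arch (↥(maximalRealSubfield L)) L (IsCMField.complexConj L) 3 (Matrix.diagonal α)) (Subgroup.centralizer ({γ₁} : Set (arch (↥(maximalRealSubfield L)) L (IsCMField.complexConj L) 3 (Matrix.diagonal α)))) (Subgroup.centralizer ({γ₂} : Set (arch (↥(maximalRealSubfield L)) L (IsCMField.complexConj L) 3 (Matrix.diagonal α)))) (forall_apply_mem_centralizer_singleton_iff_of_eq (MulAut.conj Q : arch (↥(maximalRealSubfield L)) L (IsCMField.complexConj L) 3 (Matrix.diagonal α) ≃* arch (↥(maximalRealSubfield L)) L (IsCMField.complexConj L) 3 (Matrix.diagonal α)) hQ) (continuous_mulAutConj Q) (continuous_mulAutConj_symm Q)) = T γ₂)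
    (hframe : ∀ (k : κ) (ρ : {w : InfinitePlace L // IsComplex w} → Perm (Fin 3)), ∃ (a b : L) (Tm : GL (Fin 3) (mixedSpace L)) (H_a : Matrix (Fin 2) (Fin 2) L) (H_b : Matrix (Fin 1) (Fin 1) L),
      IsSingularArchFrame L (Matrix.diagonal α) (archDiagTorus L 3 α (fun w => z0 k w ∘ ⇑(ρ w))) a b Tm H_a H_b)
    (γ : arch (↥(maximalRealSubfield L)) L (IsCMField.complexConj L) 3 (Matrix.diagonal α)) (hγ : (∃ (k : κ) (ρ : {w : InfinitePlace L // IsComplex w} → Perm (Fin 3)) (q : arch (↥(maximalRealSubfield L)) L (IsCMField.complexConj L) 3 (Matrix.diagonal α)), (MulAut.conj q : arch (↥(maximalRealSubfield L)) L (IsCMField.complexConj L) 3 (Matrix.diagonal α) ≃* arch (↥(maximalRealSubfield L)) L (IsCMField.complexConj L) 3 (Matrix.diagonal α)) (archDiagTorus L 3 α (fun w => z0 k w ∘ ⇑(ρ w))) = γ)) :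
    T γ = K⁻¹ • centralizerTopFormHaar L (Matrix.diagonal α) γ := by
  obtain ⟨k, ρ, q, hq⟩ := hγ
  -- at the wall torus point: (U) and `T (t) = ρ′ k ρ`
  have hUt := hU νH hνH hpin (z0 k) (hwall k) (hrat k) ρ (ρZ k) (hρZi k) (hρZ k) (hρZ1 k) (ρP k ρ) (hρP k ρ) (ρ' k ρ) (hρ' k ρ)
  have hTt : T (archDiagTorus L 3 α (fun w => z0 k w ∘ ⇑(ρ w))) = K⁻¹ • centralizerTopFormHaar L (Matrix.diagonal α) (archDiagTorus L 3 α (fun w => z0 k w ∘ ⇑(ρ w))) := by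
    rw [hTtor k ρ, hUt, smul_smul, inv_mul_cancel₀ hK, one_smul]
  -- carry it along the conjugator: both sides are coherent
  rw [← hcoh _ γ q hq ⟨k, ρ, 1, by simp⟩, hTt, Measure.map_smul,
    map_subgroupCongrHomeomorph_conj_centralizerTopFormHaar q hq (hframe k ρ)]

end Literature.NumberTheory.Rogawski1990

end
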